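import Mathlib
import Summits.RiemannHypothesis.RiemannHypothesis.Theses.DensityLadder
import Summits.RiemannHypothesis.RiemannHypothesis.Theorems.DensityLadderSeparatedTowerGlue
import Summits.RiemannHypothesis.RiemannHypothesis.Theorems.DensityLadderSeparatedTowerExponent
import Summits.RiemannHypothesis.RiemannHypothesis.Theorems.DensityLadderSeparatedTowerMeanValue
import HarnessLib

/-!
# `DensityLadder.ZetaSeparatedTowerBelowDensityLine` (item stmt-RiemannHypothesis-24920, target C of
# LINE L57 «sieve sight above the density line», rh-idea-10 g1) — CLOSER

C = K1 ∧ K2 by the pure-logic glue `DensityLadderSeparatedTowerGlue`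
(`zetaSeparatedTowerBelowDensityLine_of_separatedTowerDensityLine`, which already consumes the proved
K2 `ZetaIntegerPrimeConsistent_holds`, stmt-RiemannHypothesis-24919); K1 `SeparatedTowerDensityLine`
(stmt-RiemannHypothesis-24918) is S2 ∘ S1 of the registered skeleton `Birth.lean`
(`separatedTower_exponentExtraction` ∘ `separatedTower_meanValueCount`), inlined here so that this
file does not wait on the K1 closer module.
Cell rh-split, seat rh-split-prover-l57 g0.  (p)/(b⁺) FRONTIER «DENSITY-LINE CAP», DH-capped: a
statement about HYPOTHETICAL separated towers of ζ-zeros below the density line; 0 toward RH; nothing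
here bears on the truth of RH.
-/

set_option linter.dupNamespace false  -- the mandated namespace repeats `RiemannHypothesis`

namespace Summit.RiemannHypothesis.RiemannHypothesis.Theorems.DensityLadderZetaSeparatedTowerBelowDensityLine

open Summit.RiemannHypothesis.RiemannHypothesis.Theorems.DensityLadderSeparatedTowerExponent
open Summit.RiemannHypothesis.RiemannHypothesis.Theorems.DensityLadderSeparatedTowerMeanValue
open Summit.RiemannHypothesis.RiemannHypothesis.Theorems.DensityLadderSeparatedTowerGlue

/-- **C `ZetaSeparatedTowerBelowDensityLine` holds** (stmt-RiemannHypothesis-24920): every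
`g`-separated tower of off-line ζ-zeros of bounded multiplicity, discrete below `β`, has counting
exponent `e ≤ 2(1 − β)` — K1 (S2 ∘ S1) fed to the glue, K2 being proved in the route file. [folklore] -/
theorem zetaSeparatedTowerBelowDensityLine :
    Summit.RiemannHypothesis.RiemannHypothesis.Theses.DensityLadder.ZetaSeparatedTowerBelowDensityLine :=
  zetaSeparatedTowerBelowDensityLine_of_separatedTowerDensityLine (by
    intro ι m ρ w β e g hβ hβ1 hg hC hT hTower
    exact separatedTower_exponentExtraction ι ρ β e hβ hβ1 hTower.2.1
      (separatedTower_meanValueCount ι m ρ w β g hβ hβ1 hg hC hT ⟨hTower.1, hTower.2.1, hTower.2.2.1⟩)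
      hTower.2.2.2)

end Summit.RiemannHypothesis.RiemannHypothesis.Theorems.DensityLadderZetaSeparatedTowerBelowDensityLine
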